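import Literature.Geometry.Lorentzian.RelCorrespondingBoundaryDomain
import Literature.Geometry.Lorentzian.CauchyPieceDomain
import Literature.Geometry.Lorentzian.CauchyDevelopmentPieceDomain
import Literature.Geometry.Lorentzian.SpacelikePieceDomain
import Literature.Geometry.Lorentzian.CausalCurveEndpoint
import Literature.Geometry.Lorentzian.CauchyDevelopmentComap
import Literature.Geometry.Lorentzian.MaximalCommonDevelopment
import Literature.Geometry.Lorentzian.DataEmbeddingNormalSmooth
import Literature.Geometry.Lorentzian.DevelopmentGluingData
import Summits.FinalStateConjecture.FinalStateConjecture.Theorems.SwallowTheDatumSubdataDevelopmentsEmbedMCGHD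

/-!
# Route SwallowTheDatum · item `SubdataDevelopmentsEmbed` (stmt-FinalStateConjecture-10053) —
# towards hypothesis (c): a cluster point of `ψ` at `∂U` lies in the Cauchy piece domain of the
# sub-datum

Hypothesis (c) `hncb` of `subdataDevelopmentsEmbed_of_localTheory_of_cauchyRegion_of_ncb`
(`…Skeleton2`): a relative common sub-development `(U ⊆ M', ψ : U → M)` of a development `𝒟'`
of the sub-datum `D.comap Φ` and a development `𝒟` of `D`, admitting no proper extension, has
no corresponding boundary points. This file and its sequel `…NcbReduction` REDUCE it to
Sbierski's printed Theorem 12 for two developments of the SAME data (2016, §3.2; the displayed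
input `h12` of `Literature/…/MCGHDNoCorrespondingBoundary.lean`) plus the global-hyperbolicity
consequences displayed by that programme (`SpacelikeBoundaryFuturePoint.lean`) and the slab
condition of data hypersurfaces (`SpacelikePieceDomain.lean`, a theorem:
`CauchyDevelopmentPieceDomain.lean`). Here:

* `not_mem_closure_badSet_of_clusterPt` — if `q` is a cluster point of `ψ` along `U` at
  `p ∈ ∂U`, then `(p, q)` corresponds for the relative common development `(U, ψ|_U)`, so by
  `RelCorrespondingBoundaryDomain` `q ∉ closure (I⁺(K) ∪ I⁻(K) ∪ K)`, `K = ι(X) ∖ ι(Φ N)`; also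
  `ψ(U)` misses that closure, and `ψ|_U` is injective and open;
* `exists_cauchyPieceDomain` — the connected component `V ∋ ι(Φ N)` of the complement of that
  closure is an open connected region, relatively closed in the complement, in which `ι(Φ N)` is
  a Cauchy hypersurface (`CauchyPieceDomain`, `SpacelikePieceDomain`, `CausalCurveEndpoint`);
* small lemmas: components and closures, differentials of maps into / between open submanifolds,
  `ι(X) ∖ ι(Φ N)` is closed, `ι(Φ N)` is relatively open, acausality from the slab condition.

Pure composition over the tree; no definitions, no named facts.
-/

noncomputable section

open Function Set Filter Topology TopologicalSpace Bundle
open scoped Manifold ContDiff Topology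

namespace Summit.FinalStateConjecture.FinalStateConjecture.Theorems

namespace SubdataDevelopmentsEmbed

open Literature.Geometry.Lorentzian

universe u

/-! ### Two topological lemmas -/

/-- A point of `O` in the closure of the connected component `C` of `a` in `O` lies in `C`
(components are closed in the subspace `O`). [folklore] -/
theorem mem_connectedComponentIn_of_mem_closure {α : Type*} [TopologicalSpace α] {O : Set α}
    {a x : α} (hx : x ∈ closure (connectedComponentIn O a)) (hxO : x ∈ O) :
    x ∈ connectedComponentIn O a := by
  by_cases ha : a ∈ O
  · rw [connectedComponentIn_eq_image ha] at hx ⊢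
    set xO : O := ⟨x, hxO⟩
    have h1 : xO ∈ closure (connectedComponent (⟨a, ha⟩ : O)) := by
      rw [Topology.IsInducing.subtypeVal.closure_eq_preimage_closure_image]
      exact hx
    rw [isClosed_connectedComponent.closure_eq] at h1
    exact ⟨xO, h1, rfl⟩
  · rw [connectedComponentIn_eq_empty ha, closure_empty] at hx
    exact hx.elim

/-! ### Differentials of maps into and between open submanifolds -/

section OpensDeriv

variable {E : Type*} [NormedAddCommGroup E] [NormedSpace ℝ E] {H : Type*} [TopologicalSpace H]
  {I : ModelWithCorners ℝ E H} {M : Type*} [TopologicalSpace M] [ChartedSpace H M]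
  {E' : Type*} [NormedAddCommGroup E'] [NormedSpace ℝ E'] {H' : Type*} [TopologicalSpace H']
  {I' : ModelWithCorners ℝ E' H'} {M' : Type*} [TopologicalSpace M'] [ChartedSpace H' M']

/-- **The differential of a map with codomain restricted to an open subset is that of the map**
(`d(Subtype.val) = id`; cf. `DataEmbedding.mfderiv_embedOpens_apply`). Lee 2013, Prop. 3.9.
[folklore] -/
theorem mfderiv_codRestrict_opens_apply (W : Opens M) {f : M' → M} (hf : ∀ y, f y ∈ W) {x : M'}
    (hd : MDifferentiableAt I' I f x) (v : TangentSpace I' x) :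
    mfderiv I' I (fun y ↦ (⟨f y, hf y⟩ : W)) x v = mfderiv I' I f x v := by
  have hd' : MDifferentiableAt I' I (fun y ↦ (⟨f y, hf y⟩ : W)) x :=
    (mdifferentiableAt_subtypeVal_comp_iff W).1 hd
  have h := mfderiv_comp x (hasMFDerivAt_subtypeVal (I' := I) (W := W) ⟨f x, hf x⟩).mdifferentiableAt hd'
  have h' : mfderiv I' I f x v = mfderiv I I (Subtype.val : W → M) (⟨f x, hf x⟩ : W)
      (mfderiv I' I (fun y ↦ (⟨f y, hf y⟩ : W)) x v) := DFunLike.congr_fun h v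
  rw [h', mfderiv_subtypeVal]
  rfl

/-- **The differential of an extension of a map between open submanifolds**: if `F : M' → M`
restricts on the open `W' ⊆ M'` to `f : W' → W ⊆ M` (`F ∘ val = val ∘ f`), then
`dF_x = df_x` at the points of `W'`. Lee 2013, Prop. 3.9. [folklore] -/
theorem mfderiv_apply_eq_of_comp_subtypeVal (W' : Opens M') (W : Opens M) {f : W' → W} {F : M' → M}
    (hF : F ∘ Subtype.val = Subtype.val ∘ f) {x : M'} (hx : x ∈ W')
    (hdF : MDifferentiableAt I' I F x) (hdf : MDifferentiableAt I' I f ⟨x, hx⟩) (v : TangentSpace I' x) :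
    mfderiv I' I F x v = mfderiv I' I f ⟨x, hx⟩ v := by
  have h1 := mfderiv_comp_subtypeVal (I' := I') (I := I) (W := W') (y := ⟨x, hx⟩) hdF
  have h2 := mfderiv_comp (⟨x, hx⟩ : W')
    (hasMFDerivAt_subtypeVal (I' := I) (W := W) (f ⟨x, hx⟩)).mdifferentiableAt hdf
  have h5 : mfderiv I' I (F ∘ (Subtype.val : W' → M')) ⟨x, hx⟩ =
      mfderiv I' I ((Subtype.val : W → M) ∘ f) ⟨x, hx⟩ := by rw [hF]
  have e1 : (mfderiv I' I F x v : E) = mfderiv I' I (F ∘ (Subtype.val : W' → M')) ⟨x, hx⟩ v :=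
    (DFunLike.congr_fun h1 v).symm
  have e2 : (mfderiv I' I (F ∘ (Subtype.val : W' → M')) ⟨x, hx⟩ v : E) =
      mfderiv I' I ((Subtype.val : W → M) ∘ f) ⟨x, hx⟩ v := DFunLike.congr_fun h5 v
  have e3 : (mfderiv I' I ((Subtype.val : W → M) ∘ f) ⟨x, hx⟩ v : E) =
      mfderiv I I (Subtype.val : W → M) (f ⟨x, hx⟩) (mfderiv I' I f ⟨x, hx⟩ v) := DFunLike.congr_fun h2 v
  have e4 : (mfderiv I I (Subtype.val : W → M) (f ⟨x, hx⟩) (mfderiv I' I f ⟨x, hx⟩ v) : E) =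
      mfderiv I' I f ⟨x, hx⟩ v := by
    rw [mfderiv_subtypeVal]
    rfl
  exact e1.trans (e2.trans (e3.trans e4))

end OpensDeriv

variable {n : ℕ}
  {N : Type u} [TopologicalSpace N] [ChartedSpace (EuclideanSpace ℝ (Fin n)) N]
  [IsManifold (𝓡 n) ∞ N] [ConnectedSpace N] {D₁ : InitialDataSet (𝓡 n) N}
  {X : Type u} [TopologicalSpace X] [ChartedSpace (EuclideanSpace ℝ (Fin n)) X]
  [IsManifold (𝓡 n) ∞ X] [ConnectedSpace X] {D₂ : InitialDataSet (𝓡 n) X}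

omit [ChartedSpace (EuclideanSpace ℝ (Fin n)) N] [IsManifold (𝓡 n) ∞ N] [ConnectedSpace N] in
/-- **`ι(X) ∖ ι(Φ N)` is closed** for a Cauchy development `𝒟` of data on `X` and an open embedding
`Φ : N → X`: it is the image of the closed set `(Φ N)ᶜ` under the closed embedding `ι` (`ι(X)` is
closed, O'Neill's Lemma 14.29). [cite: ONeillSemiRiemannian1983, Ch. 14, Lemma 14.29 (p. 415)] -/
theorem isClosed_range_embed_diff (𝒟 : CauchyDevelopment D₂) {Φ : N → X} (hΦo : IsOpenEmbedding Φ) :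
    IsClosed (range 𝒟.embed \ range (𝒟.embed ∘ Φ)) := by
  have hn2 : (2 : ℕ∞ω) ≤ ∞ := WithTop.coe_le_coe.mpr le_top
  have hcl : IsClosed (range 𝒟.embed) :=
    LorentzianMetric.IsCauchyHypersurface.isClosed_holds hn2 𝒟.isCauchyHypersurface
  have hce : Topology.IsClosedEmbedding 𝒟.embed := ⟨𝒟.isSmoothEmbedding.isEmbedding, hcl⟩
  have heq : range 𝒟.embed \ range (𝒟.embed ∘ Φ) = 𝒟.embed '' (range Φ)ᶜ := by
    ext z
    constructor
    · rintro ⟨⟨x, rfl⟩, hz⟩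
      exact ⟨x, fun ⟨u, hu⟩ ↦ hz ⟨u, by rw [comp_apply, hu]⟩, rfl⟩
    · rintro ⟨x, hx, rfl⟩
      exact ⟨⟨x, rfl⟩, fun ⟨u, hu⟩ ↦ hx ⟨u, 𝒟.isSmoothEmbedding.isEmbedding.injective hu⟩⟩
  rw [heq]
  exact hce.isClosedMap _ hΦo.isOpen_range.isClosed_compl

omit [ChartedSpace (EuclideanSpace ℝ (Fin n)) N] [IsManifold (𝓡 n) ∞ N] [ConnectedSpace N] in
/-- **`ι(Φ N)` is relatively open in `ι(X)`** (near a point of `ι(Φ N)`, points of `ι(X)` lie in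
`ι(Φ N)`): `Φ N` is open and `ι` is an embedding. [folklore] -/
theorem eventually_mem_range_comp (𝒟 : CauchyDevelopment D₂) {Φ : N → X} (hΦo : IsOpenEmbedding Φ)
    {a : 𝒟.carrier} (ha : a ∈ range (𝒟.embed ∘ Φ)) :
    ∀ᶠ σ in 𝓝 a, σ ∈ range 𝒟.embed → σ ∈ range (𝒟.embed ∘ Φ) := by
  obtain ⟨O, hO, hpre⟩ := 𝒟.isSmoothEmbedding.isEmbedding.isInducing.isOpen_iff.1 hΦo.isOpen_range
  obtain ⟨u, rfl⟩ := ha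
  have haO : (𝒟.embed ∘ Φ) u ∈ O := by
    have h : Φ u ∈ 𝒟.embed ⁻¹' O := by rw [hpre]; exact ⟨u, rfl⟩
    exact h
  filter_upwards [hO.mem_nhds haO] with σ hσO hσS
  obtain ⟨x, rfl⟩ := hσS
  have hx : x ∈ range Φ := by rw [← hpre]; exact hσO
  obtain ⟨v, rfl⟩ := hx
  exact ⟨v, rfl⟩

/-- **A data hypersurface satisfying the slab condition is acausal** in the form
"`y ∈ J⁺(x)`, `x, y ∈ ι(X)` ⇒ `y = x`" (`IsCauchyHypersurface.false_of_isFutureCausalCurveOn_of_spacelike`).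
[cite: ONeillSemiRiemannian1983, Ch. 14, Lemma 14.42 ff. (p. 425)] -/
theorem eq_of_mem_causalFuture_of_slab (𝒟 : CauchyDevelopment D₂)
    (hslab : ∀ a ∈ range 𝒟.embed, ∃ ν : TangentSpace (𝓡 (n + 1)) a,
      𝒟.metric.IsTimelike ν ∧ 𝒟.timeOrientation.IsFutureDirected ν ∧
      ∀ κ : ℝ, 0 < κ → ∀ᶠ σ in 𝓝 a, σ ∈ range 𝒟.embed →
        |𝒟.metric.val a ν (extChartAt (𝓡 (n + 1)) a σ - extChartAt (𝓡 (n + 1)) a a)| ≤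
          κ * ‖extChartAt (𝓡 (n + 1)) a σ - extChartAt (𝓡 (n + 1)) a a‖) :
    ∀ x ∈ range 𝒟.embed, ∀ y ∈ range 𝒟.embed,
      y ∈ 𝒟.metric.causalFuture 𝒟.timeOrientation {x} → y = x := by
  have hn2 : (2 : ℕ∞ω) ≤ ∞ := WithTop.coe_le_coe.mpr le_top
  intro x hx y hy hxy
  rcases hxy with h | ⟨x', hx', γ, a, b, hab, hγ, hγa, hγb⟩
  · exact mem_singleton_iff.1 h
  · exfalso
    rw [mem_singleton_iff] at hx'
    refine LorentzianMetric.IsCauchyHypersurface.false_of_isFutureCausalCurveOn_of_spacelike hn2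
      𝒟.isCauchyHypersurface (fun a ha ↦ ?_) hab hγ (by rw [hγa, hx']; exact hx) (by rw [hγb]; exact hy)
    obtain ⟨ν, hνt, -, hsl⟩ := hslab a ha
    exact ⟨ν, hνt, hsl⟩

/-! ### Step A: a cluster point of `ψ` at a boundary point lies off the bad set -/

/-- **A cluster point `q` of `ψ` along `U` at `p ∈ ∂U` lies off `closure (I⁺(K) ∪ I⁻(K) ∪ K)`,
`K = ι(X) ∖ ι(Φ N)`**, for a relative common sub-development `(U, ψ)` given by the seven displayed
conjuncts: `(U, ψ|_U)` is a `RelCommonDevelopment`, `(p, q)` corresponds in the neighbourhood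
sense, and `RelCorrespondingBoundaryDomain` applies (its GH inputs and the slab condition
displayed). Also recorded, for the sequel: `ψ(U)` misses that closure, `ψ` is injective on `U`
and maps open subsets of `U` to open sets. [cite: Sbierski2016AHP, §3.2, Def. 11 and Thm. 12 (arXiv numbering); HawkingEllis1973CUP, §7.6, p. 250] -/
theorem not_mem_closure_badSet_of_clusterPt
    (𝒟 : VacuumCauchyDevelopment.{u} D₂) {Φ : N → X} (hΦ : ContMDiff (𝓡 n) (𝓡 n) (∞ + 1) Φ)
    (hΦ' : ∀ u, Injective (mfderiv (𝓡 n) (𝓡 n) Φ u)) (hΦo : IsOpenEmbedding Φ)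
    (𝒟' : VacuumCauchyDevelopment.{u} (D₂.comap Φ hΦ hΦ'))
    (hK : ∀ x : 𝒟.carrier, IsCompact (𝒟.metric.causalPast 𝒟.timeOrientation {x} ∩
      𝒟.metric.causalFuture 𝒟.timeOrientation (range 𝒟.embed)))
    (hK' : ∀ x : 𝒟.carrier, IsCompact (𝒟.metric.causalFuture 𝒟.timeOrientation {x} ∩
      𝒟.metric.causalPast 𝒟.timeOrientation (range 𝒟.embed)))
    (hK₁ : ∀ x : 𝒟'.carrier, IsCompact (𝒟'.metric.causalPast 𝒟'.timeOrientation {x} ∩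
      𝒟'.metric.causalFuture 𝒟'.timeOrientation (range 𝒟'.embed)))
    (hK₁' : ∀ x : 𝒟'.carrier, IsCompact (𝒟'.metric.causalFuture 𝒟'.timeOrientation {x} ∩
      𝒟'.metric.causalPast 𝒟'.timeOrientation (range 𝒟'.embed)))
    (hrel : ∀ {xs ys : ℕ → 𝒟.carrier} {x y : 𝒟.carrier}, Tendsto xs atTop (𝓝 x) →
      Tendsto ys atTop (𝓝 y) → (∀ j, ys j ∈ 𝒟.metric.causalFuture 𝒟.timeOrientation {xs j}) →
      y ∈ 𝒟.metric.causalFuture 𝒟.timeOrientation {x})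
    (hslab : ∀ a ∈ range 𝒟.embed, ∃ ν : TangentSpace (𝓡 (n + 1)) a,
      𝒟.metric.IsTimelike ν ∧ 𝒟.timeOrientation.IsFutureDirected ν ∧
      ∀ κ : ℝ, 0 < κ → ∀ᶠ σ in 𝓝 a, σ ∈ range 𝒟.embed →
        |𝒟.metric.val a ν (extChartAt (𝓡 (n + 1)) a σ - extChartAt (𝓡 (n + 1)) a a)| ≤
          κ * ‖extChartAt (𝓡 (n + 1)) a σ - extChartAt (𝓡 (n + 1)) a a‖)
    (U : Opens 𝒟'.carrier) (ψ : 𝒟'.carrier → 𝒟.carrier)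
    (hP : (∀ u, 𝒟'.embed u ∈ U) ∧ IsConnected (U : Set 𝒟'.carrier) ∧
      (𝒟'.metric.restrict PseudoRiemannianMetric.contMDiff_restrict_holds U).IsCauchyHypersurface
        (𝒟'.timeOrientation.restrict PseudoRiemannianMetric.contMDiff_restrict_holds
          𝒟'.timeOrientation.contMDiff_restrict_holds U) (Subtype.val ⁻¹' range 𝒟'.embed) ∧
      ContMDiffOn (𝓡 (n + 1)) (𝓡 (n + 1)) ∞ ψ U ∧
      (∀ p ∈ U, pullbackBilin (I := 𝓡 (n + 1)) (I' := 𝓡 (n + 1)) ψ 𝒟.metric.val p =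
        𝒟'.metric.val p) ∧
      (∀ p ∈ U, 𝒟.timeOrientation.IsFutureDirected
        (mfderiv (𝓡 (n + 1)) (𝓡 (n + 1)) ψ p (𝒟'.timeOrientation.vectorField p))) ∧
      ψ ∘ 𝒟'.embed = 𝒟.embed ∘ Φ)
    {p : 𝒟'.carrier} (hp : p ∈ frontier (U : Set 𝒟'.carrier)) {q : 𝒟.carrier}
    (hq : ClusterPt q (map ψ (𝓝[(U : Set 𝒟'.carrier)] p))) :
    q ∉ closure (𝒟.metric.chronologicalFuture 𝒟.timeOrientation
        (range 𝒟.embed \ range (𝒟.embed ∘ Φ)) ∪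
      𝒟.metric.chronologicalPast 𝒟.timeOrientation (range 𝒟.embed \ range (𝒟.embed ∘ Φ)) ∪
      (range 𝒟.embed \ range (𝒟.embed ∘ Φ))) ∧
    Disjoint (ψ '' (U : Set 𝒟'.carrier))
      (closure (𝒟.metric.chronologicalFuture 𝒟.timeOrientation
          (range 𝒟.embed \ range (𝒟.embed ∘ Φ)) ∪
        𝒟.metric.chronologicalPast 𝒟.timeOrientation (range 𝒟.embed \ range (𝒟.embed ∘ Φ)) ∪
        (range 𝒟.embed \ range (𝒟.embed ∘ Φ)))) ∧
    InjOn ψ U ∧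
    (∀ B : Set 𝒟'.carrier, IsOpen B → IsOpen (ψ '' (B ∩ (U : Set 𝒟'.carrier)))) ∧
    (∀ V ∈ 𝓝 p, ∀ V' ∈ 𝓝 q, ∃ y ∈ (U : Set 𝒟'.carrier), y ∈ V ∧ ψ y ∈ V') := by
  have hn2 : (2 : ℕ∞ω) ≤ ∞ := WithTop.coe_le_coe.mpr le_top
  obtain ⟨hι, hUc, hC, hs, hi, ht, hc⟩ := hP
  /- the relative common development `𝔠` (as in `hglue_of_relGluing`) -/
  have hsmooth : ContMDiff (𝓡 (n + 1)) (𝓡 (n + 1)) ∞ (ψ ∘ (Subtype.val : U → 𝒟'.carrier)) :=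
    hs.comp_contMDiff contMDiff_subtype_val fun p ↦ p.2
  have hmf : ∀ (y : U) (v : TangentSpace (𝓡 (n + 1)) y),
      mfderiv (𝓡 (n + 1)) (𝓡 (n + 1)) (ψ ∘ (Subtype.val : U → 𝒟'.carrier)) y v =
        mfderiv (𝓡 (n + 1)) (𝓡 (n + 1)) ψ y.1 v := by
    intro y v
    have hd : MDifferentiableAt (𝓡 (n + 1)) (𝓡 (n + 1)) ψ y.1 :=
      ((hs y.1 y.2).contMDiffAt (U.2.mem_nhds y.2)).mdifferentiableAt (by simp)
    rw [mfderiv_comp y hd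
      (hasMFDerivAt_subtypeVal (I' := 𝓡 (n + 1)) (W := U) y).mdifferentiableAt, mfderiv_subtypeVal]
    rfl
  have hiso : (𝒟'.metric.restrict PseudoRiemannianMetric.contMDiff_restrict_holds U).IsIsometricImmersion
      𝒟.metric.toPseudoRiemannianMetric (ψ ∘ (Subtype.val : U → 𝒟'.carrier)) := by
    refine ⟨hsmooth, fun (y : U) ↦ ?_⟩
    ext v w
    have hk := congrArg (fun b ↦ b v w) (hi y.1 y.2)
    simp only [pullbackBilin_apply] at hk
    change 𝒟.metric.val (ψ y.1)
        (mfderiv (𝓡 (n + 1)) (𝓡 (n + 1)) (ψ ∘ (Subtype.val : U → 𝒟'.carrier)) y v)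
        (mfderiv (𝓡 (n + 1)) (𝓡 (n + 1)) (ψ ∘ (Subtype.val : U → 𝒟'.carrier)) y w) =
      𝒟'.metric.val y.1 v w
    rw [hmf y v, hmf y w]
    exact hk
  have hτ : (𝒟'.timeOrientation.restrict PseudoRiemannianMetric.contMDiff_restrict_holds
      𝒟'.timeOrientation.contMDiff_restrict_holds U).PreservesTimeOrientation
      (ψ ∘ (Subtype.val : U → 𝒟'.carrier)) 𝒟.timeOrientation := fun (y : U) ↦ by
    change 𝒟.timeOrientation.IsFutureDirected
      (mfderiv (𝓡 (n + 1)) (𝓡 (n + 1)) (ψ ∘ (Subtype.val : U → 𝒟'.carrier)) y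
        (𝒟'.timeOrientation.vectorField y.1))
    rw [hmf]
    exact ht y.1 y.2
  have hinjOn : InjOn ψ U :=
    injOn_of_relCGHD 𝒟'.toCauchyDevelopment 𝒟.toCauchyDevelopment hΦo.injective
      (fun x ↦ 𝒟'.toDataEmbedding.mdifferentiableAt_embed_normal x) hι hUc hC hs hi ht hc
  let 𝔠 : CauchyDevelopment.RelCommonDevelopment 𝒟'.toCauchyDevelopment 𝒟.toCauchyDevelopment Φ :=
    { opens := U
      embed_mem := hι
      isCauchyHypersurface := hC
      map := ψ ∘ (Subtype.val : U → 𝒟'.carrier)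
      isIsometricImmersion := hiso
      preservesTimeOrientation := hτ
      map_comp_embedOpens := funext fun u ↦ congrFun hc u
      injective_map := fun y₁ y₂ h ↦ Subtype.ext (hinjOn y₁.2 y₂.2 h) }
  /- `(p, q)` corresponds in the neighbourhood sense -/
  have hcorr : ∀ V ∈ 𝓝 p, ∀ V' ∈ 𝓝 q, ∃ y ∈ (U : Set 𝒟'.carrier), y ∈ V ∧ ψ y ∈ V' := by
    intro V hV V' hV'
    have hmem : ψ '' (V ∩ (U : Set 𝒟'.carrier)) ∈ map ψ (𝓝[(U : Set 𝒟'.carrier)] p) :=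
      image_mem_map (Filter.inter_mem (mem_nhdsWithin_of_mem_nhds hV) self_mem_nhdsWithin)
    obtain ⟨z, hzV', y, ⟨hyV, hyU⟩, rfl⟩ := (clusterPt_iff_nonempty.1 hq) hV' hmem
    exact ⟨y, hyU, hyV, hzV'⟩
  have hcorr' : ∀ V ∈ 𝓝 p, ∀ V' ∈ 𝓝 q, ∃ y : 𝔠.opens, (y : 𝒟'.carrier) ∈ V ∧ 𝔠.map y ∈ V' := by
    intro V hV V' hV'
    obtain ⟨y, hyU, hyV, hy⟩ := hcorr V hV V' hV'
    exact ⟨⟨y, hyU⟩, hyV, hy⟩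
  have hrange : range 𝔠.map = ψ '' (U : Set 𝒟'.carrier) := by
    ext z
    constructor
    · rintro ⟨y, rfl⟩
      exact ⟨y.1, y.2, rfl⟩
    · rintro ⟨y, hyU, rfl⟩
      exact ⟨⟨y, hyU⟩, rfl⟩
  refine ⟨?_, ?_, hinjOn, fun B hB ↦ ?_, hcorr⟩
  · exact 𝔠.not_mem_closure_badSet_of_corresponding hK₁ hK₁' hK hK' hrel
      (eq_of_mem_causalFuture_of_slab 𝒟.toCauchyDevelopment hslab)
      (isClosed_range_embed_diff 𝒟.toCauchyDevelopment hΦo) hp hcorr'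
  · rw [← hrange]
    exact 𝔠.disjoint_range_map_closure_badSet
  · have heq : ψ '' (B ∩ (U : Set 𝒟'.carrier)) = 𝔠.map '' ((Subtype.val : U → 𝒟'.carrier) ⁻¹' B) := by
      ext z
      constructor
      · rintro ⟨b, ⟨hbB, hbU⟩, rfl⟩
        exact ⟨⟨b, hbU⟩, hbB, rfl⟩
      · rintro ⟨b, hbB, rfl⟩
        exact ⟨b.1, ⟨hbB, b.2⟩, rfl⟩
    rw [heq]
    exact 𝔠.isOpenEmbedding_map.isOpenMap _ (hB.preimage continuous_subtype_val)

/-! ### Step B: the Cauchy piece domain of the sub-datum -/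

omit [ChartedSpace (EuclideanSpace ℝ (Fin n)) N] [IsManifold (𝓡 n) ∞ N] in
/-- **The Cauchy piece domain of `ι(Φ N)`**: the connected component `V` through `ι(Φ n₀)` of the
complement of `closure (I⁺(K) ∪ I⁻(K) ∪ K)`, `K = ι(X) ∖ ι(Φ N)`, is an open connected region
containing `ι(Φ N)`, disjoint from that closure and relatively closed in its complement, in which
`ι(Φ N)` is a Cauchy hypersurface (`CauchyPieceDomain`, `SpacelikePieceDomain` with the slab
condition of the data hypersurface, endpoint property from `CausalCurveEndpoint`).
[cite: HawkingEllis1973CUP, §6.5 and Prop. 6.6.3; ONeillSemiRiemannian1983, Ch. 14, Lemma 14.43] -/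
theorem exists_cauchyPieceDomain (𝒟 : VacuumCauchyDevelopment.{u} D₂) {Φ : N → X}
    (hΦo : IsOpenEmbedding Φ)
    (hslab : ∀ a ∈ range 𝒟.embed, ∃ ν : TangentSpace (𝓡 (n + 1)) a,
      𝒟.metric.IsTimelike ν ∧ 𝒟.timeOrientation.IsFutureDirected ν ∧
      ∀ κ : ℝ, 0 < κ → ∀ᶠ σ in 𝓝 a, σ ∈ range 𝒟.embed →
        |𝒟.metric.val a ν (extChartAt (𝓡 (n + 1)) a σ - extChartAt (𝓡 (n + 1)) a a)| ≤
          κ * ‖extChartAt (𝓡 (n + 1)) a σ - extChartAt (𝓡 (n + 1)) a a‖)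
    (n₀ : N) :
    ∃ V : Opens 𝒟.carrier,
      (V : Set 𝒟.carrier) = connectedComponentIn
        (closure (𝒟.metric.chronologicalFuture 𝒟.timeOrientation
            (range 𝒟.embed \ range (𝒟.embed ∘ Φ)) ∪
          𝒟.metric.chronologicalPast 𝒟.timeOrientation (range 𝒟.embed \ range (𝒟.embed ∘ Φ)) ∪
          (range 𝒟.embed \ range (𝒟.embed ∘ Φ))))ᶜ (𝒟.embed (Φ n₀)) ∧
      IsConnected (V : Set 𝒟.carrier) ∧ (∀ u, 𝒟.embed (Φ u) ∈ V) ∧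
      closure (V : Set 𝒟.carrier) \
        closure (𝒟.metric.chronologicalFuture 𝒟.timeOrientation
            (range 𝒟.embed \ range (𝒟.embed ∘ Φ)) ∪
          𝒟.metric.chronologicalPast 𝒟.timeOrientation (range 𝒟.embed \ range (𝒟.embed ∘ Φ)) ∪
          (range 𝒟.embed \ range (𝒟.embed ∘ Φ))) ⊆ V ∧
      (𝒟.metric.restrict PseudoRiemannianMetric.contMDiff_restrict_holds V).IsCauchyHypersurface
        (𝒟.timeOrientation.restrict PseudoRiemannianMetric.contMDiff_restrict_holds
          𝒟.timeOrientation.contMDiff_restrict_holds V) (Subtype.val ⁻¹' range (𝒟.embed ∘ Φ)) := by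
  have hn2 : (2 : ℕ∞ω) ≤ ∞ := WithTop.coe_le_coe.mpr le_top
  set F : Set 𝒟.carrier := 𝒟.metric.chronologicalFuture 𝒟.timeOrientation
      (range 𝒟.embed \ range (𝒟.embed ∘ Φ)) ∪
    𝒟.metric.chronologicalPast 𝒟.timeOrientation (range 𝒟.embed \ range (𝒟.embed ∘ Φ)) ∪
    (range 𝒟.embed \ range (𝒟.embed ∘ Φ)) with hF_def
  have hS₀S : range (𝒟.embed ∘ Φ) ⊆ range 𝒟.embed := range_comp_subset_range Φ 𝒟.embed
  have hA : Disjoint (range (𝒟.embed ∘ Φ)) (closure F) :=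
    LorentzianMetric.IsCauchyHypersurface.disjoint_closure_of_spacelike hn2 𝒟.isCauchyHypersurface
      hS₀S (fun a ha ↦ eventually_mem_range_comp 𝒟.toCauchyDevelopment hΦo ha)
      (fun a ha ↦ hslab a (hS₀S ha))
  have ha₀F : 𝒟.embed (Φ n₀) ∈ (closure F)ᶜ := Set.disjoint_left.1 hA ⟨n₀, rfl⟩
  haveI : LocallyConnectedSpace 𝒟.carrier :=
    ChartedSpace.locallyConnectedSpace (EuclideanSpace ℝ (Fin (n + 1))) 𝒟.carrier
  refine ⟨⟨connectedComponentIn (closure F)ᶜ (𝒟.embed (Φ n₀)),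
    isClosed_closure.isOpen_compl.connectedComponentIn⟩, rfl, ?_, ?_, ?_, ?_⟩
  · exact ⟨⟨_, mem_connectedComponentIn ha₀F⟩, isPreconnected_connectedComponentIn⟩
  · intro u
    exact (isConnected_range
      (𝒟.isSmoothEmbedding.contMDiff.continuous.comp hΦo.continuous)).isPreconnected.subset_connectedComponentIn
      (⟨n₀, rfl⟩ : 𝒟.embed (Φ n₀) ∈ range (𝒟.embed ∘ Φ)) (Set.disjoint_left.1 hA) ⟨u, rfl⟩
  · exact fun x hx ↦ mem_connectedComponentIn_of_mem_closure hx.1 hx.2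
  · haveI : 𝒟.metric.toPseudoRiemannianMetric.HasLeviCivita :=
      𝒟.metric.toPseudoRiemannianMetric.hasLeviCivita
    haveI : CovariantDerivative.ContMDiffCovariantDerivative 𝒟.metric.leviCivita 1 :=
      ⟨𝒟.metric.isLocallyContMDiff_leviCivita_holds 1 (by exact_mod_cast le_top) univ isOpen_univ⟩
    refine LorentzianMetric.IsCauchyHypersurface.restrict_of_disjoint_closure hn2
      (fun hs' hc' he ht₁ ht₂ htt ↦ LorentzianMetric.mem_chronologicalFuture_of_hasPastEndpoint
        𝒟.timeOrientation le_rfl hs' hc' he ht₁ ht₂ htt)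
      (fun hs' hc' he ht₁ ht₂ htt ↦ LorentzianMetric.mem_chronologicalFuture_of_hasPastEndpoint
        𝒟.timeOrientation.reverse le_rfl hs' hc' he ht₁ ht₂ htt)
      PseudoRiemannianMetric.contMDiff_restrict_holds 𝒟.timeOrientation.contMDiff_restrict_holds
      𝒟.isCauchyHypersurface hS₀S _ ?_ ?_ ?_
    · exact (isConnected_range
        (𝒟.isSmoothEmbedding.contMDiff.continuous.comp hΦo.continuous)).isPreconnected.subset_connectedComponentIn
        (⟨n₀, rfl⟩ : 𝒟.embed (Φ n₀) ∈ range (𝒟.embed ∘ Φ)) (Set.disjoint_left.1 hA)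
    · exact Set.disjoint_left.2 fun x hx hxF ↦ connectedComponentIn_subset _ _ hx hxF
    · exact fun x hx ↦ mem_connectedComponentIn_of_mem_closure hx.1 hx.2

end SubdataDevelopmentsEmbed

end Summit.FinalStateConjecture.FinalStateConjecture.Theorems

end
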